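import Summits.QuantumFields.YangMills.Theses.LimitSetRigidity
import Literature.MathematicalPhysics.QuantumFieldTheory.Balaban1983to89.T3ThresholdRemoval

/-!
# Birth skeleton (BC3) for the crux `LimitSetRigidity.SlowVariationL`

Two registered stubs + the kernel-checked composition `SlowVariationL_of` (pure real analysis: an `ε/3` argument).
* `stub_largeFieldTruncation` — ONE run, `K`-uniform: truncating the unit expectation to Bałaban's small-field event
  `{u | PlaqSmall δ₀ u}` of the UNIT law costs `≤ ε` uniformly in the cutoff once `δ₀ = δ₀(ε)` (K-uniform large-field mass of the
  unit laws; in print modulo (α): CMP 122 large-field renormalisation; tree `Expectations3T.LargeFieldImprobable` is the summable form).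
* `stub_smallFieldAgreement` — TWO consecutive runs, RATE-FREE: on every fixed small-field event of the unit lattice the truncated
  expectations of runs `K+1` and `K` become equal in the limit (the genuinely open piece; no summability asked).
-/

namespace Summit.QuantumFields.YangMills.Theses.LimitSetRigidity

-- the crux decl `SlowVariationL` is the ROUTE FILE's (imported above); the composition below concludes it BY NAME
open scoped BigOperators Topology
open Filter MeasureTheory

namespace Cruxes.SlowVariationL.Birth

open Literature.MathematicalPhysics.QuantumFieldTheory.Balaban1983to89
  Literature.MathematicalPhysics.QuantumFieldTheory.Balaban1983to89.T3ContinuumYM3Torus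
  Literature.MathematicalPhysics.QuantumFieldTheory.Balaban1983to89.T3NestedUnitLaws
  Literature.MathematicalPhysics.QuantumFieldTheory.Balaban1983to89.T3UnitLawDensityEML
  Literature.MathematicalPhysics.QuantumFieldTheory.Balaban1983to89.T4Continuum

/-- The small-field TRUNCATED unit expectation of run `K`: `∫ 1_{PlaqSmall δ₀}(u) ∏_{C∈Cs} W_C(u) d(unitLaw K)(u)`. -/
noncomputable def truncExpect (F : T3Family) (γ δ₀ : ℝ) (K : ℕ) (Cs : List (ULoop3 F)) : ℝ :=
  ∫ u, Set.indicator {u | PlaqSmall δ₀ u} (fun _ => (1 : ℝ)) u * (Cs.map fun C => loopAt u (C.1.atLevel 0)).prod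
    ∂(F.unitLaw ℰp measurableE_ℰp γ K)

/-- STUB 1 (one run, K-uniform large-field truncation; size M): for every `ε > 0` there is a small-field threshold `δ₀ > 0`
such that at EVERY cutoff `K` the unit expectation differs from its small-field truncation by at most `ε`. -/
theorem stub_largeFieldTruncation :
    ∃ γ₁ : ℝ, 0 < γ₁ ∧ ∀ (F : T3Family) (γ : ℝ), 0 < γ → γ ≤ γ₁ →
      ∀ ε : ℝ, 0 < ε → ∃ δ₀ : ℝ, 0 < δ₀ ∧ ∀ (K : ℕ) (Cs : List (ULoop3 F)),
        |(F.scheme ℰp γ).expectAt K Cs - truncExpect F γ δ₀ K Cs| ≤ ε := by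
  sorry

/-- STUB 2 (two consecutive runs, rate-free small-field agreement; size L — the hard one): for every fixed threshold
`δ₀ > 0` and loop string `Cs`, the small-field truncated unit expectations of runs `K+1` and `K` differ by `o(1)`. -/
theorem stub_smallFieldAgreement :
    ∃ γ₁ : ℝ, 0 < γ₁ ∧ ∀ (F : T3Family) (γ : ℝ), 0 < γ → γ ≤ γ₁ →
      ∀ δ₀ : ℝ, 0 < δ₀ → ∀ Cs : List (ULoop3 F),
        Tendsto (fun K : ℕ => truncExpect F γ δ₀ (K + 1) Cs - truncExpect F γ δ₀ K Cs) atTop (𝓝 0) := by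
  sorry

/-- COMPOSITION (kernel-checked, no sorry): the two stubs give the crux BY NAME (`ε/3` argument). -/
theorem SlowVariationL_of
    (h₁ : ∃ γ₁ : ℝ, 0 < γ₁ ∧ ∀ (F : T3Family) (γ : ℝ), 0 < γ → γ ≤ γ₁ →
      ∀ ε : ℝ, 0 < ε → ∃ δ₀ : ℝ, 0 < δ₀ ∧ ∀ (K : ℕ) (Cs : List (ULoop3 F)),
        |(F.scheme ℰp γ).expectAt K Cs - truncExpect F γ δ₀ K Cs| ≤ ε)
    (h₂ : ∃ γ₁ : ℝ, 0 < γ₁ ∧ ∀ (F : T3Family) (γ : ℝ), 0 < γ → γ ≤ γ₁ →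
      ∀ δ₀ : ℝ, 0 < δ₀ → ∀ Cs : List (ULoop3 F),
        Tendsto (fun K : ℕ => truncExpect F γ δ₀ (K + 1) Cs - truncExpect F γ δ₀ K Cs) atTop (𝓝 0)) :
    Summit.QuantumFields.YangMills.Theses.LimitSetRigidity.SlowVariationL := by
  obtain ⟨γ₁, hγ₁, h₁⟩ := h₁
  obtain ⟨γ₂, hγ₂, h₂⟩ := h₂
  refine ⟨min γ₁ γ₂, lt_min hγ₁ hγ₂, fun F γ hγ hle Cs => ?_⟩
  rw [Metric.tendsto_atTop]
  intro ε hε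
  have hε4 : 0 < ε / 4 := by positivity
  obtain ⟨δ₀, hδ₀, htr⟩ := h₁ F γ hγ (hle.trans (min_le_left _ _)) (ε / 4) hε4
  have hsf := h₂ F γ hγ (hle.trans (min_le_right _ _)) δ₀ hδ₀ Cs
  rw [Metric.tendsto_atTop] at hsf
  obtain ⟨N, hN⟩ := hsf (ε / 4) hε4
  refine ⟨N, fun K hK => ?_⟩
  have h3 := hN K hK
  rw [Real.dist_eq, sub_zero] at h3 ⊢
  have hK1 := htr (K + 1) Cs
  have hK0 := htr K Cs
  calc |(F.scheme ℰp γ).expectAt (K + 1) Cs - (F.scheme ℰp γ).expectAt K Cs|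
      = |((F.scheme ℰp γ).expectAt (K + 1) Cs - truncExpect F γ δ₀ (K + 1) Cs)
          + (truncExpect F γ δ₀ (K + 1) Cs - truncExpect F γ δ₀ K Cs)
          - ((F.scheme ℰp γ).expectAt K Cs - truncExpect F γ δ₀ K Cs)| := by ring_nf
    _ ≤ |(F.scheme ℰp γ).expectAt (K + 1) Cs - truncExpect F γ δ₀ (K + 1) Cs|
          + |truncExpect F γ δ₀ (K + 1) Cs - truncExpect F γ δ₀ K Cs|
          + |(F.scheme ℰp γ).expectAt K Cs - truncExpect F γ δ₀ K Cs| := abs_add_sub_le_three _ _ _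
    _ < ε := by linarith

where
  /-- `|a + b - c| ≤ |a| + |b| + |c|`. -/
  abs_add_sub_le_three (a b c : ℝ) : |a + b - c| ≤ |a| + |b| + |c| := by
    calc |a + b - c| ≤ |a + b| + |c| := abs_sub _ _
      _ ≤ |a| + |b| + |c| := by linarith [abs_add_le a b]

/-- The composition applied to the stubs: the crux, modulo exactly the two sorries above. -/
theorem slowVariationL_of_stubs : Summit.QuantumFields.YangMills.Theses.LimitSetRigidity.SlowVariationL :=
  SlowVariationL_of stub_largeFieldTruncation stub_smallFieldAgreement

end Cruxes.SlowVariationL.Birth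

end Summit.QuantumFields.YangMills.Theses.LimitSetRigidity
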